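import Summits.Ventures.CertifiedManyBodySolver.Observables.SourcedGibbsTrialCapAFRiemannEnergy
import Summits.Ventures.CertifiedManyBodySolver.Observables.SourcedGibbsTrialCapBandTwoGrid
import HarnessLib

/-!
# The AF–BCS sourced cap in momentum space (XV-g): two-grid bounds for the three AF momentum sums

Cell hubbard-obs (seat hubbard-obs-pin-2). HONEST FRAMING: zero compute; the Davis–Rabinowitz two-grid control
(`AF-TL-PACKAGING.md`, step 3 COMPLETE with this file) of the momentum sums of the certified AF–BCS cap
`groundEnergy_dWaveSourceTorus_le_AFBCS_kSpace`: per site, the density coefficient sum `Σ_k c₀₀`, the staggered-moment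
coefficient sum `Σ_k c_{Q0}` and the energy coefficient sum `Σ_k (ξ_k c₀₀ + G_k c₁₀ + M c_{Q0})` on two grids `L, L'`
differ by at most `2π·K·(1/L + 1/L')` with `K = (β/2)(2 + 2√2|h|)` (density, moment) and `K = (5/2)(2 + 2√2|h|)`
(energy, β-free) — for `μ' ≠ 0`, `M ≠ 0` (all published AF rows), every `β ≥ 0`. The cap's own sums are these up to
the pointwise identities `d₁₁ = 1 − c₀₀`, `d_{Q1} = c_{Q0}`, `u↑ + u↓ = 2(ξc₀₀ + Gc₁₀ + Mc_{Q0}) − ξ` (successor's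
row file). ONE certified grid `L₁` therefore controls every `L ≥ L₁`. No number is claimed; not a statement about
order; not a superconductivity verdict.

References: Davis–Rabinowitz (1984) §2.1 eq. (2.1.6) [DavisRabinowitz1984]; Bach–Lieb–Solovej (1994) §2
[BachLiebSolovej1994].
-/

noncomputable section

open Real Finset Literature.MathematicalPhysics.QuantumLattice Literature.Probability.LatticeModels

namespace Summit.Ventures.CertifiedManyBodySolver.Observables

/-- **Two-grid bound for the AF density coefficient sum** `Σ_k c₀₀(ε_k, G_k)`: per site the grids `L, L'` differ by at most `2π·(β/4·2)(2 + 2√2|h|)·(1/L + 1/L')` (`β ≥ 0`, `μ' ≠ 0`, `M ≠ 0`). [cite: DavisRabinowitz1984, §2.1 eq. (2.1.6)] -/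
theorem abs_afDensityCoeff_two_grid_le (L L' : ℕ) [NeZero L] [NeZero L'] {β μ' M : ℝ} (hβ : 0 ≤ β) (hμ : μ' ≠ 0) (hM : M ≠ 0) (h : ℝ) :
    |(∑ k : TorusSite 2 L, (1 / 2 - Real.tanh (β * Real.sqrt ((Real.sqrt (torusBand L k ^ 2 + M ^ 2) + |μ'|) ^ 2 + (2 * Real.sqrt 2 * h * dWaveGap k) ^ 2) / 2) / (2 * Real.sqrt ((Real.sqrt (torusBand L k ^ 2 + M ^ 2) + |μ'|) ^ 2 + (2 * Real.sqrt 2 * h * dWaveGap k) ^ 2)) * ((torusBand L k - μ') / 2 - μ' / (2 * |μ'| * Real.sqrt (torusBand L k ^ 2 + M ^ 2)) * (torusBand L k ^ 2 + M ^ 2 - torusBand L k * μ')) - Real.tanh (β * Real.sqrt ((Real.sqrt (torusBand L k ^ 2 + M ^ 2) - |μ'|) ^ 2 + (2 * Real.sqrt 2 * h * dWaveGap k) ^ 2) / 2) / (2 * Real.sqrt ((Real.sqrt (torusBand L k ^ 2 + M ^ 2) - |μ'|) ^ 2 + (2 * Real.sqrt 2 * h * dWaveGap k) ^ 2)) * ((torusBand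 L k - μ') / 2 + μ' / (2 * |μ'| * Real.sqrt (torusBand L k ^ 2 + M ^ 2)) * (torusBand L k ^ 2 + M ^ 2 - torusBand L k * μ')))) / (L : ℝ) ^ 2 -
      (∑ k : TorusSite 2 L', (1 / 2 - Real.tanh (β * Real.sqrt ((Real.sqrt (torusBand L' k ^ 2 + M ^ 2) + |μ'|) ^ 2 + (2 * Real.sqrt 2 * h * dWaveGap k) ^ 2) / 2) / (2 * Real.sqrt ((Real.sqrt (torusBand L' k ^ 2 + M ^ 2) + |μ'|) ^ 2 + (2 * Real.sqrt 2 * h * dWaveGap k) ^ 2)) * ((torusBand L' k - μ') / 2 - μ' / (2 * |μ'| * Real.sqrt (torusBand L' k ^ 2 + M ^ 2)) * (torusBand L' k ^ 2 + M ^ 2 - torusBand L' k * μ')) - Real.tanh (β * Real.sqrt ((Real.sqrt (torusBand L' k ^ 2 + M ^ 2) - |μ'|) ^ 2 + (2 * Real.sqrt 2 * h * dWaveGap k) ^ 2) / 2) / (2 * Real.sqrt ((Real.sqrt (torusBand L' k ^ 2 + M ^ 2) - |μ'|) ^ 2 + (2 * Real.sqrt 2 * h * dWaveGap k) ^ 2))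 * ((torusBand L' k - μ') / 2 + μ' / (2 * |μ'| * Real.sqrt (torusBand L' k ^ 2 + M ^ 2)) * (torusBand L' k ^ 2 + M ^ 2 - torusBand L' k * μ')))) / (L' : ℝ) ^ 2| ≤
      2 * π * (β / 4 * 2 * (2 + 2 * Real.sqrt 2 * |h|)) * (1 / (L : ℝ) + 1 / (L' : ℝ)) :=
  abs_bandFn_two_grid_le L L' (φ := fun ε G => (1 / 2 - Real.tanh (β * Real.sqrt ((Real.sqrt (ε ^ 2 + M ^ 2) + |μ'|) ^ 2 + G ^ 2) / 2) / (2 * Real.sqrt ((Real.sqrt (ε ^ 2 + M ^ 2) + |μ'|) ^ 2 + G ^ 2)) * ((ε - μ') / 2 - μ' / (2 * |μ'| * Real.sqrt (ε ^ 2 + M ^ 2)) * (ε ^ 2 + M ^ 2 - ε * μ')) - Real.tanh (β * Real.sqrt ((Real.sqrt (ε ^ 2 + M ^ 2) - |μ'|) ^ 2 + G ^ 2) / 2) / (2 * Real.sqrt ((Real.sqrt (ε ^ 2 + M ^ 2) - |μ'|) ^ 2 + G ^ 2)) * ((ε - μ') / 2 + μ' / (2 * |μ'| * Real.sqrt (ε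 ^ 2 + M ^ 2)) * (ε ^ 2 + M ^ 2 - ε * μ')))) (by positivity) (fun ε G ε' G' => (abs_afDensityCoeff_sub_le hβ hμ hM ε G ε' G').trans_eq (by ring)) h

/-- **Two-grid bound for the AF staggered-moment coefficient sum** `Σ_k c_{Q0}(ε_k, G_k)` (`β ≥ 0`, `μ' ≠ 0`, `M ≠ 0`). [cite: DavisRabinowitz1984, §2.1 eq. (2.1.6)] -/
theorem abs_afMomentCoeff_two_grid_le (L L' : ℕ) [NeZero L] [NeZero L'] {β μ' M : ℝ} (hβ : 0 ≤ β) (hμ : μ' ≠ 0) (hM : M ≠ 0) (h : ℝ) :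
    |(∑ k : TorusSite 2 L, (-M * (Real.tanh (β * Real.sqrt ((Real.sqrt (torusBand L k ^ 2 + M ^ 2) + |μ'|) ^ 2 + (2 * Real.sqrt 2 * h * dWaveGap k) ^ 2) / 2) / (2 * Real.sqrt ((Real.sqrt (torusBand L k ^ 2 + M ^ 2) + |μ'|) ^ 2 + (2 * Real.sqrt 2 * h * dWaveGap k) ^ 2)) * (1 / 2 + μ' / (2 * |μ'| * Real.sqrt (torusBand L k ^ 2 + M ^ 2)) * μ') + Real.tanh (β * Real.sqrt ((Real.sqrt (torusBand L k ^ 2 + M ^ 2) - |μ'|) ^ 2 + (2 * Real.sqrt 2 * h * dWaveGap k) ^ 2) / 2) / (2 * Real.sqrt ((Real.sqrt (torusBand L k ^ 2 + M ^ 2) - |μ'|) ^ 2 + (2 * Real.sqrt 2 * h * dWaveGap k) ^ 2)) * (1 / 2 - μ' / (2 * |μ'| * Real.sqrt (torusBand L k ^ 2 + M ^ 2)) * μ')))) / (L : ℝ) ^ 2 -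
      (∑ k : TorusSite 2 L', (-M * (Real.tanh (β * Real.sqrt ((Real.sqrt (torusBand L' k ^ 2 + M ^ 2) + |μ'|) ^ 2 + (2 * Real.sqrt 2 * h * dWaveGap k) ^ 2) / 2) / (2 * Real.sqrt ((Real.sqrt (torusBand L' k ^ 2 + M ^ 2) + |μ'|) ^ 2 + (2 * Real.sqrt 2 * h * dWaveGap k) ^ 2)) * (1 / 2 + μ' / (2 * |μ'| * Real.sqrt (torusBand L' k ^ 2 + M ^ 2)) * μ') + Real.tanh (β * Real.sqrt ((Real.sqrt (torusBand L' k ^ 2 + M ^ 2) - |μ'|) ^ 2 + (2 * Real.sqrt 2 * h * dWaveGap k) ^ 2) / 2) / (2 * Real.sqrt ((Real.sqrt (torusBand L' k ^ 2 + M ^ 2) - |μ'|) ^ 2 + (2 * Real.sqrt 2 * h * dWaveGap k) ^ 2)) * (1 / 2 - μ' / (2 * |μ'| * Real.sqrt (torusBand L' k ^ 2 + M ^ 2)) * μ')))) / (L' : ℝ) ^ 2| ≤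
      2 * π * (β / 4 * 2 * (2 + 2 * Real.sqrt 2 * |h|)) * (1 / (L : ℝ) + 1 / (L' : ℝ)) :=
  abs_bandFn_two_grid_le L L' (φ := fun ε G => (-M * (Real.tanh (β * Real.sqrt ((Real.sqrt (ε ^ 2 + M ^ 2) + |μ'|) ^ 2 + G ^ 2) / 2) / (2 * Real.sqrt ((Real.sqrt (ε ^ 2 + M ^ 2) + |μ'|) ^ 2 + G ^ 2)) * (1 / 2 + μ' / (2 * |μ'| * Real.sqrt (ε ^ 2 + M ^ 2)) * μ') + Real.tanh (β * Real.sqrt ((Real.sqrt (ε ^ 2 + M ^ 2) - |μ'|) ^ 2 + G ^ 2) / 2) / (2 * Real.sqrt ((Real.sqrt (ε ^ 2 + M ^ 2) - |μ'|) ^ 2 + G ^ 2)) * (1 / 2 - μ' / (2 * |μ'| * Real.sqrt (ε ^ 2 + M ^ 2)) * μ')))) (by positivity) (fun ε G ε' G' => (abs_afMomentCoeff_sub_le hβ hμ hM ε G ε' G').trans_eq (by ring)) h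

/-- **Two-grid bound for the AF energy coefficient sum** `Σ_k (ξ_k c₀₀ + G_k c₁₀ + M c_{Q0})(ε_k, G_k)`, constant `(5/4·2)(2 + 2√2|h|)` uniformly in `β` (`μ' ≠ 0`, `M ≠ 0`). [cite: DavisRabinowitz1984, §2.1 eq. (2.1.6)] -/
theorem abs_afEnergyCoeff_two_grid_le (L L' : ℕ) [NeZero L] [NeZero L'] {β μ' M : ℝ} (hμ : μ' ≠ 0) (hM : M ≠ 0) (h : ℝ) :
    |(∑ k : TorusSite 2 L, ((torusBand L k - μ') * (1 / 2 - Real.tanh (β * Real.sqrt ((Real.sqrt (torusBand L k ^ 2 + M ^ 2) + |μ'|) ^ 2 + (2 * Real.sqrt 2 * h * dWaveGap k) ^ 2) / 2) / (2 * Real.sqrt ((Real.sqrt (torusBand L k ^ 2 + M ^ 2) + |μ'|) ^ 2 + (2 * Real.sqrt 2 * h * dWaveGap k) ^ 2)) * ((torusBand L k - μ') / 2 - μ' / (2 * |μ'| * Real.sqrt (torusBand L k ^ 2 + M ^ 2)) * (torusBand L k ^ 2 + M ^ 2 - torusBand L k * μ')) - Real.tanh (β * Real.sqrt ((Real.sqrt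 (torusBand L k ^ 2 + M ^ 2) - |μ'|) ^ 2 + (2 * Real.sqrt 2 * h * dWaveGap k) ^ 2) / 2) / (2 * Real.sqrt ((Real.sqrt (torusBand L k ^ 2 + M ^ 2) - |μ'|) ^ 2 + (2 * Real.sqrt 2 * h * dWaveGap k) ^ 2)) * ((torusBand L k - μ') / 2 + μ' / (2 * |μ'| * Real.sqrt (torusBand L k ^ 2 + M ^ 2)) * (torusBand L k ^ 2 + M ^ 2 - torusBand L k * μ'))) + (2 * Real.sqrt 2 * h * dWaveGap k) * (-(2 * Real.sqrt 2 * h * dWaveGap k) * (Real.tanh (β * Real.sqrt ((Real.sqrt (torusBand L k ^ 2 + M ^ 2) + |μ'|) ^ 2 + (2 * Real.sqrt 2 * h * dWaveGap k) ^ 2) / 2) / (2 * Real.sqrt ((Real.sqrt (torusBand L k ^ 2 + M ^ 2) + |μ'|) ^ 2 + (2 * Real.sqrt 2 * h * dWaveGap k) ^ 2)) * (1 / 2 - μ' / (2 * |μ'| * Real.sqrt (torusBand L k ^ 2 + M ^ 2)) * torusBand L k) + Real.tanh (β * Real.sqrt ((Real.sqrt (torusBand L k ^ 2 + M ^ 2)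 - |μ'|) ^ 2 + (2 * Real.sqrt 2 * h * dWaveGap k) ^ 2) / 2) / (2 * Real.sqrt ((Real.sqrt (torusBand L k ^ 2 + M ^ 2) - |μ'|) ^ 2 + (2 * Real.sqrt 2 * h * dWaveGap k) ^ 2)) * (1 / 2 + μ' / (2 * |μ'| * Real.sqrt (torusBand L k ^ 2 + M ^ 2)) * torusBand L k))) + M * (-M * (Real.tanh (β * Real.sqrt ((Real.sqrt (torusBand L k ^ 2 + M ^ 2) + |μ'|) ^ 2 + (2 * Real.sqrt 2 * h * dWaveGap k) ^ 2) / 2) / (2 * Real.sqrt ((Real.sqrt (torusBand L k ^ 2 + M ^ 2) + |μ'|) ^ 2 + (2 * Real.sqrt 2 * h * dWaveGap k) ^ 2)) * (1 / 2 + μ' / (2 * |μ'| * Real.sqrt (torusBand L k ^ 2 + M ^ 2)) * μ') + Real.tanh (β * Real.sqrt ((Real.sqrt (torusBand L k ^ 2 + M ^ 2) - |μ'|) ^ 2 + (2 * Real.sqrt 2 * h * dWaveGap k) ^ 2) / 2) / (2 * Real.sqrt ((Real.sqrt (torusBand L k ^ 2 + M ^ 2) - |μ'|) ^ 2 + (2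 * Real.sqrt 2 * h * dWaveGap k) ^ 2)) * (1 / 2 - μ' / (2 * |μ'| * Real.sqrt (torusBand L k ^ 2 + M ^ 2)) * μ'))))) / (L : ℝ) ^ 2 -
      (∑ k : TorusSite 2 L', ((torusBand L' k - μ') * (1 / 2 - Real.tanh (β * Real.sqrt ((Real.sqrt (torusBand L' k ^ 2 + M ^ 2) + |μ'|) ^ 2 + (2 * Real.sqrt 2 * h * dWaveGap k) ^ 2) / 2) / (2 * Real.sqrt ((Real.sqrt (torusBand L' k ^ 2 + M ^ 2) + |μ'|) ^ 2 + (2 * Real.sqrt 2 * h * dWaveGap k) ^ 2)) * ((torusBand L' k - μ') / 2 - μ' / (2 * |μ'| * Real.sqrt (torusBand L' k ^ 2 + M ^ 2)) * (torusBand L' k ^ 2 + M ^ 2 - torusBand L' k * μ')) - Real.tanh (β * Real.sqrt ((Real.sqrt (torusBand L' k ^ 2 + M ^ 2) - |μ'|) ^ 2 + (2 * Real.sqrt 2 * h * dWaveGap k) ^ 2) / 2) / (2 * Real.sqrt ((Real.sqrt (torusBand L' k ^ 2 + M ^ 2) - |μ'|) ^ 2 + (2 * Real.sqrt 2 * h *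 dWaveGap k) ^ 2)) * ((torusBand L' k - μ') / 2 + μ' / (2 * |μ'| * Real.sqrt (torusBand L' k ^ 2 + M ^ 2)) * (torusBand L' k ^ 2 + M ^ 2 - torusBand L' k * μ'))) + (2 * Real.sqrt 2 * h * dWaveGap k) * (-(2 * Real.sqrt 2 * h * dWaveGap k) * (Real.tanh (β * Real.sqrt ((Real.sqrt (torusBand L' k ^ 2 + M ^ 2) + |μ'|) ^ 2 + (2 * Real.sqrt 2 * h * dWaveGap k) ^ 2) / 2) / (2 * Real.sqrt ((Real.sqrt (torusBand L' k ^ 2 + M ^ 2) + |μ'|) ^ 2 + (2 * Real.sqrt 2 * h * dWaveGap k) ^ 2)) * (1 / 2 - μ' / (2 * |μ'| * Real.sqrt (torusBand L' k ^ 2 + M ^ 2)) * torusBand L' k) + Real.tanh (β * Real.sqrt ((Real.sqrt (torusBand L' k ^ 2 + M ^ 2) - |μ'|) ^ 2 + (2 * Real.sqrt 2 * h * dWaveGap k) ^ 2) / 2) / (2 * Real.sqrt ((Real.sqrt (torusBand L' k ^ 2 + M ^ 2) - |μ'|) ^ 2 + (2 * Real.sqrt 2 * h * dWaveGap k) ^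 2)) * (1 / 2 + μ' / (2 * |μ'| * Real.sqrt (torusBand L' k ^ 2 + M ^ 2)) * torusBand L' k))) + M * (-M * (Real.tanh (β * Real.sqrt ((Real.sqrt (torusBand L' k ^ 2 + M ^ 2) + |μ'|) ^ 2 + (2 * Real.sqrt 2 * h * dWaveGap k) ^ 2) / 2) / (2 * Real.sqrt ((Real.sqrt (torusBand L' k ^ 2 + M ^ 2) + |μ'|) ^ 2 + (2 * Real.sqrt 2 * h * dWaveGap k) ^ 2)) * (1 / 2 + μ' / (2 * |μ'| * Real.sqrt (torusBand L' k ^ 2 + M ^ 2)) * μ') + Real.tanh (β * Real.sqrt ((Real.sqrt (torusBand L' k ^ 2 + M ^ 2) - |μ'|) ^ 2 + (2 * Real.sqrt 2 * h * dWaveGap k) ^ 2) / 2) / (2 * Real.sqrt ((Real.sqrt (torusBand L' k ^ 2 + M ^ 2) - |μ'|) ^ 2 + (2 * Real.sqrt 2 * h * dWaveGap k) ^ 2)) * (1 / 2 - μ' / (2 * |μ'| * Real.sqrt (torusBand L' k ^ 2 + M ^ 2)) * μ'))))) / (L' : ℝ) ^ 2| ≤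
      2 * π * (5 / 4 * 2 * (2 + 2 * Real.sqrt 2 * |h|)) * (1 / (L : ℝ) + 1 / (L' : ℝ)) :=
  abs_bandFn_two_grid_le L L' (φ := fun ε G => ((ε - μ') * (1 / 2 - Real.tanh (β * Real.sqrt ((Real.sqrt (ε ^ 2 + M ^ 2) + |μ'|) ^ 2 + G ^ 2) / 2) / (2 * Real.sqrt ((Real.sqrt (ε ^ 2 + M ^ 2) + |μ'|) ^ 2 + G ^ 2)) * ((ε - μ') / 2 - μ' / (2 * |μ'| * Real.sqrt (ε ^ 2 + M ^ 2)) * (ε ^ 2 + M ^ 2 - ε * μ')) - Real.tanh (β * Real.sqrt ((Real.sqrt (ε ^ 2 + M ^ 2) - |μ'|) ^ 2 + G ^ 2) / 2) / (2 * Real.sqrt ((Real.sqrt (ε ^ 2 + M ^ 2) - |μ'|) ^ 2 + G ^ 2)) * ((ε - μ') / 2 + μ' / (2 * |μ'| * Real.sqrt (ε ^ 2 + M ^ 2)) * (ε ^ 2 + M ^ 2 - ε * μ'))) + G * (-G * (Real.tanh (β * Real.sqrt ((Real.sqrt (ε ^ 2 + M ^ 2) + |μ'|) ^ 2 + G ^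 2) / 2) / (2 * Real.sqrt ((Real.sqrt (ε ^ 2 + M ^ 2) + |μ'|) ^ 2 + G ^ 2)) * (1 / 2 - μ' / (2 * |μ'| * Real.sqrt (ε ^ 2 + M ^ 2)) * ε) + Real.tanh (β * Real.sqrt ((Real.sqrt (ε ^ 2 + M ^ 2) - |μ'|) ^ 2 + G ^ 2) / 2) / (2 * Real.sqrt ((Real.sqrt (ε ^ 2 + M ^ 2) - |μ'|) ^ 2 + G ^ 2)) * (1 / 2 + μ' / (2 * |μ'| * Real.sqrt (ε ^ 2 + M ^ 2)) * ε))) + M * (-M * (Real.tanh (β * Real.sqrt ((Real.sqrt (ε ^ 2 + M ^ 2) + |μ'|) ^ 2 + G ^ 2) / 2) / (2 * Real.sqrt ((Real.sqrt (ε ^ 2 + M ^ 2) + |μ'|) ^ 2 + G ^ 2)) * (1 / 2 + μ' / (2 * |μ'| * Real.sqrt (ε ^ 2 + M ^ 2)) * μ') + Real.tanh (β * Real.sqrt ((Real.sqrt (ε ^ 2 + M ^ 2) - |μ'|) ^ 2 + G ^ 2) / 2) / (2 * Real.sqrt ((Real.sqrt (ε ^ 2 + M ^ 2) - |μ'|)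 ^ 2 + G ^ 2)) * (1 / 2 - μ' / (2 * |μ'| * Real.sqrt (ε ^ 2 + M ^ 2)) * μ'))))) (by positivity) (fun ε G ε' G' => (abs_afEnergyCoeff_sub_le β hμ hM ε G ε' G').trans_eq (by ring)) h

end Summit.Ventures.CertifiedManyBodySolver.Observables
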